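import Mathlib
import Literature.NumberTheory.Transcendental.ZagierDilogarithmConjecture
import HarnessLib

/-!
# `τ`-symmetric combinations over a biquadratic field `ℚ(√e, √−d)` are self-similar

Stub `stub_biquadraticSymmetric` of the line `kummer-clausen-linearisation` (reshape c2,
"Galois descent") for the crux `ZagierDilogarithmConjecture` (stmt-KontsevichZagierPeriods-10550,
route `HyperbolicBloch`).

Write `C := AddSubgroup.closure dilogRelators ⊆ ℤ[ℂ]` (`FreeAbelianGroup ℂ`) and
`ℚ̄ := algebraicClosure ℚ ℂ`. For a combination `β = Σ nᵢ[zᵢ]` put `ξ := Σ nᵢ([zᵢ] − [z̄ᵢ])`, and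
for a `ℚ`-embedding `σ : ℚ̄ → ℂ` together with lifts `wᵢ, w'ᵢ ∈ ℚ̄` of `zᵢ, z̄ᵢ` put
`σ_*ξ := Σ nᵢ([σwᵢ] − [σw'ᵢ])`. The combination is *self-similar* if for every `σ` (and lifts)
there are integers `A ≠ 0`, `B` with `A•σ_*ξ − B•ξ ∈ C`.

**The biquadratic `τ`-symmetric case** (`stub_biquadraticSymmetric`): let `s = √e`,
`t = √d·i` (`d, e ∈ ℕ`) and `zᵢ = aᵢ + bᵢ s + (cᵢ + fᵢ s) t` with `aᵢ, bᵢ, cᵢ, fᵢ ∈ ℚ`, and suppose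
the combination is symmetric under `τ : √e ↦ −√e` through a permutation `π` of the indices
(`n ∘ π = n`, `(a, b, c, f) ∘ π = (a, −b, c, −f)`). Then it is self-similar, with `(A, B) = (1, ±1)`.

Proof: lift `s, t` to `S, T ∈ ℚ̄` (roots of `X² − e`, `X² + d`). A `ℚ`-algebra map `σ` satisfies
`(σS)² = e = s²` and `(σT)² = −d = t²`, so `σS = ±s`, `σT = ±t`; and in `ℚ̄` the lifts are
`wᵢ = aᵢ + bᵢS + (cᵢ + fᵢS)T`, `w'ᵢ = aᵢ + bᵢS − (cᵢ + fᵢS)T` (`s̄ = s`, `t̄ = −t`). Hence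
`[σwᵢ] − [σw'ᵢ] = ε([z_{ρ i}] − [z̄_{ρ i}])` for all `i`, where `ε = ±1` is the sign of `σT/t` and
`ρ = 1` (if `σS = s`) or `ρ = π` (if `σS = −s`, using the `τ`-symmetry). Reindexing the sum by `ρ`
(`n ∘ ρ = n`) gives `σ_*ξ = ε•ξ`, so `1•σ_*ξ − ε•ξ = 0 ∈ C`.

Sources: Neumann 1998 §2 (the relator group); Zagier 2007 Ch. I §§3–4. The computation itself is
elementary Galois theory of `ℚ(√e, √−d)` [folklore].
Not here: the propagation of `Σ nᵢ D(zᵢ) = 0` from self-similarity (`stub_selfSimilar`) and the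
one-complex-place case — separate stubs of the line.
-/

noncomputable section

open scoped BigOperators ComplexConjugate
open Literature.NumberTheory.Transcendental

namespace Summit.KontsevichZagierPeriods.HyperbolicBloch.ZagierDilogarithmGaloisDescent

/-- Reindexing a twisted combination: if `[uᵢ] − [vᵢ] = ε•([z_{ρ i}] − [z̄_{ρ i}])` for all `i`, with
`ρ` a permutation preserving the multiplicities `n`, then
`Σ nᵢ([uᵢ] − [vᵢ]) = ε • Σ nᵢ([zᵢ] − [z̄ᵢ])` in `ℤ[ℂ]`. [folklore] -/
theorem sum_zsmul_of_sub_of_eq_zsmul_of_perm {k : ℕ} (z u v : Fin k → ℂ) (n : Fin k → ℤ)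
    (ρ : Equiv.Perm (Fin k)) (ε : ℤ) (hρ : ∀ i, n (ρ i) = n i)
    (hε : ∀ i, FreeAbelianGroup.of (u i) - FreeAbelianGroup.of (v i) =
      ε • (FreeAbelianGroup.of (z (ρ i)) - FreeAbelianGroup.of (conj (z (ρ i))))) :
    ∑ i, n i • (FreeAbelianGroup.of (u i) - FreeAbelianGroup.of (v i)) =
      ε • ∑ i, n i • (FreeAbelianGroup.of (z i) - FreeAbelianGroup.of (conj (z i))) := by
  simp only [hε]
  rw [Finset.smul_sum]
  exact Fintype.sum_equiv ρ _ _ fun i => by rw [hρ i, smul_smul, smul_smul, mul_comm]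

/-- **`τ`-symmetric combinations over `ℚ(√e, √−d)` are self-similar.** Points
`zᵢ = aᵢ + bᵢ√e + (cᵢ + fᵢ√e)·√d·i` (`aᵢ, bᵢ, cᵢ, fᵢ ∈ ℚ`, `d, e ∈ ℕ`); the combination `Σ nᵢ[zᵢ]`
is symmetric under `τ : √e ↦ −√e` through a permutation `π` of the indices (`n ∘ π = n`,
`(a, b, c, f) ∘ π = (a, −b, c, −f)`). Then for every `ℚ`-embedding `σ : ℚ̄ → ℂ` and all lifts
`wᵢ, w'ᵢ ∈ ℚ̄` of `zᵢ, z̄ᵢ` there are `A ≠ 0`, `B ∈ ℤ` (namely `A = 1`, `B = ±1`) with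
`A•σ_*ξ − B•ξ ∈ ⟨dilogRelators⟩`, where `ξ = Σ nᵢ([zᵢ] − [z̄ᵢ])` and
`σ_*ξ = Σ nᵢ([σwᵢ] − [σw'ᵢ])`: `σ(√e) = ±√e` and `σ(√d·i) = ±√d·i`, so `σ_*ξ = ξ` (signs `++`,
`−+`, reindexing by `π`) or `σ_*ξ = −ξ` (signs `+−`, `−−`), and the difference is `0`. [folklore] -/
theorem stub_biquadraticSymmetric :
    ∀ (d e : ℕ) (k : ℕ) (z : Fin k → ℂ) (n : Fin k → ℤ) (a b c f : Fin k → ℚ) (π : Equiv.Perm (Fin k)),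
      (∀ i, z i = a i + b i * (Real.sqrt e : ℂ) +
        (c i + f i * (Real.sqrt e : ℂ)) * ((Real.sqrt d : ℂ) * Complex.I)) →
      (∀ i, n (π i) = n i ∧ a (π i) = a i ∧ b (π i) = -b i ∧ c (π i) = c i ∧ f (π i) = -f i) →
        ∀ (σ : ↥(algebraicClosure ℚ ℂ) →ₐ[ℚ] ℂ) (w w' : Fin k → ↥(algebraicClosure ℚ ℂ)),
          (∀ i, (w i : ℂ) = z i) → (∀ i, (w' i : ℂ) = conj (z i)) →
          ∃ A B : ℤ, A ≠ 0 ∧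
            A • (∑ i, n i • (FreeAbelianGroup.of (σ (w i)) - FreeAbelianGroup.of (σ (w' i)))) -
              B • (∑ i, n i • (FreeAbelianGroup.of (z i) - FreeAbelianGroup.of (conj (z i)))) ∈
                AddSubgroup.closure dilogRelators := by
  intro d e k z n a b c f π hz hπ σ w w' hw hw'
  -- `s = √e`, `t = √d·i`: `s² = e`, `t² = −d`, `s̄ = s`, `t̄ = −t`, both algebraic
  set s : ℂ := (Real.sqrt e : ℂ) with hs
  set t : ℂ := (Real.sqrt d : ℂ) * Complex.I with ht
  have hs2 : s ^ 2 = (e : ℂ) := by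
    rw [hs, ← Complex.ofReal_pow, Real.sq_sqrt (Nat.cast_nonneg _), Complex.ofReal_natCast]
  have ht2 : t ^ 2 = -(d : ℂ) := by
    rw [ht, mul_pow, Complex.I_sq, ← Complex.ofReal_pow, Real.sq_sqrt (Nat.cast_nonneg _),
      Complex.ofReal_natCast, mul_neg_one]
  have hsc : conj s = s := by rw [hs, Complex.conj_ofReal]
  have htc : conj t = -t := by rw [ht, map_mul, Complex.conj_ofReal, Complex.conj_I, mul_neg]
  have hsa : IsAlgebraic ℚ s := by
    refine ⟨Polynomial.X ^ 2 - Polynomial.C (e : ℚ),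
      Polynomial.X_pow_sub_C_ne_zero (by norm_num) _, ?_⟩
    simp [hs2]
  have hta : IsAlgebraic ℚ t := by
    refine ⟨Polynomial.X ^ 2 + Polynomial.C (d : ℚ),
      Polynomial.X_pow_add_C_ne_zero (by norm_num) _, ?_⟩
    simp [ht2]
  have hz' : ∀ i, conj (z i) = a i + b i * s - (c i + f i * s) * t := fun i => by
    rw [hz i]
    simp only [map_add, map_mul, hsc, htc, map_ratCast]
    ring
  -- lifts `S, T ∈ ℚ̄` of `s, t`; `σ S = ± s`, `σ T = ± t`
  obtain ⟨S, hS⟩ : ∃ S : ↥(algebraicClosure ℚ ℂ), (S : ℂ) = s :=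
    ⟨⟨s, mem_algebraicClosure_iff.2 hsa⟩, rfl⟩
  obtain ⟨T, hT⟩ : ∃ T : ↥(algebraicClosure ℚ ℂ), (T : ℂ) = t :=
    ⟨⟨t, mem_algebraicClosure_iff.2 hta⟩, rfl⟩
  have hσS : σ S = s ∨ σ S = -s := by
    refine sq_eq_sq_iff_eq_or_eq_neg.1 ?_
    have e' : S ^ 2 = ((e : ℚ) : ↥(algebraicClosure ℚ ℂ)) := Subtype.ext (by
      push_cast
      rw [hS, hs2])
    rw [← map_pow, e', map_ratCast, Rat.cast_natCast, hs2]
  have hσT : σ T = t ∨ σ T = -t := by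
    refine sq_eq_sq_iff_eq_or_eq_neg.1 ?_
    have e' : T ^ 2 = ((-d : ℚ) : ↥(algebraicClosure ℚ ℂ)) := Subtype.ext (by
      push_cast
      rw [hT, ht2])
    rw [← map_pow, e', map_ratCast, Rat.cast_neg, Rat.cast_natCast, ht2]
  -- the lifts in coordinates: `wᵢ = aᵢ + bᵢS + (cᵢ + fᵢS)T`, `w'ᵢ = aᵢ + bᵢS − (cᵢ + fᵢS)T`
  have hσw : ∀ i, σ (w i) = a i + b i * σ S + (c i + f i * σ S) * σ T := fun i => by
    have e' : w i = (a i : ↥(algebraicClosure ℚ ℂ)) + (b i : ↥(algebraicClosure ℚ ℂ)) * S +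
        ((c i : ↥(algebraicClosure ℚ ℂ)) + (f i : ↥(algebraicClosure ℚ ℂ)) * S) * T :=
      Subtype.ext (by
        push_cast
        rw [hw i, hz i, hS, hT])
    simp only [e', map_add, map_mul, map_ratCast]
  have hσw' : ∀ i, σ (w' i) = a i + b i * σ S - (c i + f i * σ S) * σ T := fun i => by
    have e' : w' i = (a i : ↥(algebraicClosure ℚ ℂ)) + (b i : ↥(algebraicClosure ℚ ℂ)) * S -
        ((c i : ↥(algebraicClosure ℚ ℂ)) + (f i : ↥(algebraicClosure ℚ ℂ)) * S) * T :=
      Subtype.ext (by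
        push_cast
        rw [hw' i, hz' i, hS, hT])
    simp only [e', map_add, map_sub, map_mul, map_ratCast]
  -- the four sign cases: `[σwᵢ] − [σw'ᵢ] = ε([z_{ρ i}] − [z̄_{ρ i}])` with `ε = ±1`, `ρ ∈ {1, π}`
  obtain ⟨ρ, ε, hρ, hε⟩ : ∃ (ρ : Equiv.Perm (Fin k)) (ε : ℤ), (∀ i, n (ρ i) = n i) ∧
      ∀ i, FreeAbelianGroup.of (σ (w i)) - FreeAbelianGroup.of (σ (w' i)) =
        ε • (FreeAbelianGroup.of (z (ρ i)) - FreeAbelianGroup.of (conj (z (ρ i)))) := by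
    rcases hσS with hS' | hS' <;> rcases hσT with hT' | hT'
    · -- `σ S = s`, `σ T = t`: `σwᵢ = zᵢ`, `σw'ᵢ = z̄ᵢ`
      refine ⟨Equiv.refl _, 1, fun _ => rfl, fun i => ?_⟩
      have e1 : σ (w i) = z i := by rw [hσw i, hS', hT', hz i]
      have e2 : σ (w' i) = conj (z i) := by rw [hσw' i, hS', hT', hz' i]
      rw [e1, e2, one_zsmul, Equiv.refl_apply]
    · -- `σ S = s`, `σ T = −t`: `σwᵢ = z̄ᵢ`, `σw'ᵢ = zᵢ`
      refine ⟨Equiv.refl _, -1, fun _ => rfl, fun i => ?_⟩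
      have e1 : σ (w i) = conj (z i) := by rw [hσw i, hS', hT', hz' i]; ring
      have e2 : σ (w' i) = z i := by rw [hσw' i, hS', hT', hz i]; ring
      rw [e1, e2, neg_one_zsmul, neg_sub, Equiv.refl_apply]
    · -- `σ S = −s`, `σ T = t`: `σwᵢ = z_{π i}`, `σw'ᵢ = z̄_{π i}`
      refine ⟨π, 1, fun i => (hπ i).1, fun i => ?_⟩
      obtain ⟨-, ha', hb', hc', hf'⟩ := hπ i
      have e1 : σ (w i) = z (π i) := by
        rw [hσw i, hS', hT', hz (π i), ha', hb', hc', hf']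
        push_cast
        ring
      have e2 : σ (w' i) = conj (z (π i)) := by
        rw [hσw' i, hS', hT', hz' (π i), ha', hb', hc', hf']
        push_cast
        ring
      rw [e1, e2, one_zsmul]
    · -- `σ S = −s`, `σ T = −t`: `σwᵢ = z̄_{π i}`, `σw'ᵢ = z_{π i}`
      refine ⟨π, -1, fun i => (hπ i).1, fun i => ?_⟩
      obtain ⟨-, ha', hb', hc', hf'⟩ := hπ i
      have e1 : σ (w i) = conj (z (π i)) := by
        rw [hσw i, hS', hT', hz' (π i), ha', hb', hc', hf']
        push_cast
        ring
      have e2 : σ (w' i) = z (π i) := by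
        rw [hσw' i, hS', hT', hz (π i), ha', hb', hc', hf']
        push_cast
        ring
      rw [e1, e2, neg_one_zsmul, neg_sub]
  -- `σ_*ξ = ε•ξ`, so `1•σ_*ξ − ε•ξ = 0 ∈ C`
  refine ⟨1, ε, one_ne_zero, ?_⟩
  rw [sum_zsmul_of_sub_of_eq_zsmul_of_perm z _ _ n ρ ε hρ hε, one_zsmul, sub_self]
  exact zero_mem _

end Summit.KontsevichZagierPeriods.HyperbolicBloch.ZagierDilogarithmGaloisDescent

end
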